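import Literature.AnabelianGeometry.SemiGraphs.TemperedReconstructionReductionsProofs
import Literature.AnabelianGeometry.SemiGraphs.TemperedReconstructionR1Proofs
import Literature.AnabelianGeometry.SemiGraphs.TemperedReconstructionR4Proofs
import Literature.AnabelianGeometry.SemiGraphs.TemperedVerticialDistinctSameVertex
import HarnessLib

/-!
# Semi-graphs of anabelioids, §3: Corollary 3.9 — assembly of the landed steps

Mochizuki, *Semi-graphs of anabelioids*, Publ. RIMS **42** (2006), §3, Corollary 3.9, manuscript
pp. 42–43 [cite: MochizukiSemiAnbd2006, Cor 3.9 pp.42-43].  Proof-only: the reduction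
`corollary_3_9_of_steps` (`TemperedReconstructionReductions.lean`) with every residual that the tree
has meanwhile PROVED bound by name —

* Thm. 3.7 (ii) `VerticialDistinct` = `verticialDistinct_holds` (abc-iut-L3-t8);
* R0 `InducedIsQuasiGeometric` = `InducedIsQuasiGeometric_of` (from Thm. 3.7 (i), (iv));
* R1 `InducesCompatible` = `InducesCompatible_holds` (abc-iut-L3-d2, over abc-iut-L3-t10's
  `conj_of_chartPullback_iso`);
* R4 `CompatibleEdgeMapUnique` = `CompatibleEdgeMapUnique_of` (abc-iut-L3-d2) modulo the edge
  analogue `EdgeLikeDistinct` of Thm. 3.7 (ii).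

HONEST RESIDUAL SET of Cor. 3.9 as typed, after this file: Thm. 3.7 (i) `VerticialInjective`,
Thm. 3.7 (iv) `MaximalCompactIffVerticial`, `EdgeLikeDistinct`, R2 `QuasiGeometricGraphData`
(its vertex and edge maps are already determined: `existsUnique_vertexMap_of_isQuasiGeometric`,
`existsUnique_edgeMap_of_isQuasiGeometric`), R3 `InducesOfCompatible` (temperoid level).
Nothing here takes a side on [IUTchIII] Cor. 3.12; typed ≠ discharged.
-/

namespace Literature.AnabelianGeometry.SemiGraphs

namespace ProfiniteSemiGraph

universe u

/-- **[SemiAnbd] Cor. 3.9 from its honest residual set** (2026-08-25): Thm. 3.7 (i), (iv), the edge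
analogue of Thm. 3.7 (ii), the graph-data step R2 and the temperoid-level step R3.
[cite: MochizukiSemiAnbd2006, Cor 3.9 pp.42-43] -/
theorem corollary_3_9_of_residuals (h37i : VerticialInjective.{u})
    (h37iv : MaximalCompactIffVerticial.{u}) (hED : EdgeLikeDistinct.{u})
    (hR2 : QuasiGeometricGraphData.{u}) (hR3 : InducesOfCompatible.{u}) : Cor39.{u} :=
  corollary_3_9_of_thm37 h37i verticialDistinct_holds h37iv InducesCompatible_holds hR2 hR3
    (CompatibleEdgeMapUnique_of hED h37i)

end ProfiniteSemiGraph

end Literature.AnabelianGeometry.SemiGraphs
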